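/-
Copyright (c) 2026 the pub-hodgecm-mathlib formalisation cell (harness21).  Prover seat hodgecm-mathlib-B-p04 (g35), heir of the EP pen of the (R2) Euler–Poincaré
road (offer (ii) of B-p14 (g32) 2026-09-01T09:23Z; A-p17 (g22) 09:37Z «finiteness ×3 on G = U₂»), 2026-09-01.
-/
import Literature.NumberTheory.Automorphic.UnitOrbitalIntegralFixedPoints   -- ★ `finite_fixedBy_quotient_of_isClosed`
import HarnessLib

/-!
# Finiteness of fixed cosets and of the orbit of the base coset for an element with compact centraliser (Kottwitz 1986 §3; Laumon 1996 (5.3.2))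

Topic `NumberTheory/Automorphic`; namespace `Literature.NumberTheory.Automorphic`.  THEOREMS ONLY (no definition, no instance, no notation, no named fact, no
`sorry`); kernel lane.  Cell `pub/hodgecm-mathlib` (D-0151), crux H413 (`stmt-HodgeConjecture-24833`), line «N6nsGerm», the Euler–Poincaré road (R2)
`stub_N6nsR2EP : RankOneEulerPoincareNonsplit`: the three FINITENESS binders `hCfin hC′fin horb` of the tree-side elliptic relation ★
`HermitianLatticeTree.natCard_fixedBy_add_eq_natCard_fixedBy_add_one_congr` (A-p17 (g22), (T4)) — stated on the MODEL group `G` (the CM carrier `U₂`, or any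
locally compact group), discharged for an element `γ` with COMPACT centraliser and CLOSED conjugacy class (a regular elliptic element) and compact open levels.
HONEST LABEL: HC_CM is proved only modulo the cell's remaining named inputs (hLiu418, h413) until rung 0 closes; nothing printed is asserted here — point-set
topology of `G ⧸ K` for `K` open (a DISCRETE space).

* §1 `finite_range_pow_quotient_of_isOpen` — `{γⁿ K | n ∈ ℕ}` is finite: `γⁿ ∈ Z(γ)` compact, and the image of a compact set in the discrete `G ⧸ K` is finite
  (`horb`); `finite_image_mk_of_isCompact` (any compact `S ⊆ G` has finite image in `G ⧸ K`).
* §2 `coe_map_conj_eq_image`, `isOpen_map_conj`, `isCompact_map_conj` — the conjugate level `g K g⁻¹ = K.map (MulAut.conj g)` is again compact open (the second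
  vertex stabiliser `K′ = g₁ K g₁⁻¹` of the tree).
* §3 **`finite_fixedBy_quotient_and_of_isClosed`** — the packaged triple `(Fix_γ(G⧸C)).Finite ∧ (Fix_γ(G⧸C′)).Finite ∧ {γⁿC}.Finite` for `C, C′` compact open,
  `Z(γ)` compact, the class of `γ` closed (★ `finite_fixedBy_quotient_of_isClosed` ×2 + §1); `…_map_conj_…` — the same with `C′ := g C g⁻¹`.

## References
* [Kottwitz1986] R. E. Kottwitz, *Base change for unit elements of Hecke algebras*, Compositio Math. 60 (1986), §3 (orbital integrals of units as finite lattice counts).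
* [Laumon1995] G. Laumon, *Cohomology of Drinfeld Modular Varieties* I (1996), Lemma (5.3.2) p. 136 (finiteness of the fixed-point set).
* [Kottwitz1988] R. E. Kottwitz, *Tamagawa numbers*, Ann. of Math. 127 (1988), §2 (the fixed-point set of an elliptic element in the building is a finite complex).
-/

set_option autoImplicit false

open Topology Set

namespace Literature.NumberTheory.Automorphic

/-! ## §1 The orbit of the base coset under `⟨γ⟩` -/

section Orbit

variable {G : Type*} [Group G] [TopologicalSpace G] [IsTopologicalGroup G]

/-- The image of a compact subset of `G` in `G ⧸ K` is finite when `K` is open (`G ⧸ K` is discrete). [cite: Laumon1995, Lemma (5.3.2) p. 136] -/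
theorem finite_image_mk_of_isCompact (K : Subgroup G) (hK : IsOpen (K : Set G)) {S : Set G} (hS : IsCompact S) :
    ((fun x : G => (x : G ⧸ K)) '' S).Finite := by
  haveI : DiscreteTopology (G ⧸ K) := QuotientGroup.discreteTopology hK
  exact (hS.image continuous_quotient_mk').finite_of_discrete

/-- **`{γⁿ K | n ∈ ℕ}` IS FINITE** for `γ` with compact centraliser and `K` open: the powers of `γ` lie in the compact group `Z(γ)`, whose image in the
discrete space `G ⧸ K` is finite — the binder `horb` of ★ `HermitianLatticeTree.natCard_fixedBy_add_eq_natCard_fixedBy_add_one_congr`.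
[cite: Kottwitz1988, §2] [cite: Laumon1995, Lemma (5.3.2) p. 136] -/
theorem finite_range_pow_quotient_of_isOpen (γ : G) (K : Subgroup G) [CompactSpace (Subgroup.centralizer ({γ} : Set G))]
    (hK : IsOpen (K : Set G)) : (Set.range fun n : ℕ => ((γ ^ n : G) : G ⧸ K)).Finite := by
  have hZ : IsCompact ((Subgroup.centralizer ({γ} : Set G) : Subgroup G) : Set G) := isCompact_iff_compactSpace.2 inferInstance
  refine (finite_image_mk_of_isCompact K hK hZ).subset ?_
  rintro x ⟨n, rfl⟩
  refine ⟨γ ^ n, ?_, rfl⟩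
  rw [SetLike.mem_coe, Subgroup.mem_centralizer_singleton_iff]
  exact (Commute.self_pow γ n).eq.symm

/-- The `ℤ`-powers version: `{γⁿ K | n ∈ ℤ}` is finite. [cite: Kottwitz1988, §2] -/
theorem finite_range_zpow_quotient_of_isOpen (γ : G) (K : Subgroup G) [CompactSpace (Subgroup.centralizer ({γ} : Set G))]
    (hK : IsOpen (K : Set G)) : (Set.range fun n : ℤ => ((γ ^ n : G) : G ⧸ K)).Finite := by
  have hZ : IsCompact ((Subgroup.centralizer ({γ} : Set G) : Subgroup G) : Set G) := isCompact_iff_compactSpace.2 inferInstance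
  refine (finite_image_mk_of_isCompact K hK hZ).subset ?_
  rintro x ⟨n, rfl⟩
  refine ⟨γ ^ n, ?_, rfl⟩
  rw [SetLike.mem_coe, Subgroup.mem_centralizer_singleton_iff]
  exact (Commute.self_zpow γ n).eq.symm

end Orbit

/-! ## §2 Conjugate levels -/

section Conj

variable {G : Type*} [Group G] [TopologicalSpace G] [IsTopologicalGroup G]

omit [TopologicalSpace G] [IsTopologicalGroup G] in
/-- `g K g⁻¹` as a set: the image of `K` under `x ↦ g x g⁻¹`. [cite: Kottwitz1986, §3] -/
theorem coe_map_conj_eq_image (K : Subgroup G) (g : G) :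
    ((K.map (MulAut.conj g).toMonoidHom : Subgroup G) : Set G) = (fun x => g * x * g⁻¹) '' (K : Set G) := by
  rw [Subgroup.coe_map]; rfl

/-- A conjugate `g K g⁻¹` of an open subgroup is open. [cite: Kottwitz1986, §3] -/
theorem isOpen_map_conj (K : Subgroup G) (hK : IsOpen (K : Set G)) (g : G) :
    IsOpen ((K.map (MulAut.conj g).toMonoidHom : Subgroup G) : Set G) := by
  rw [Subgroup.coe_map]
  have : (⇑(MulAut.conj g).toMonoidHom : G → G) = (Homeomorph.mulLeft g).trans (Homeomorph.mulRight g⁻¹) := by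
    ext x; rfl
  rw [this]
  exact (Homeomorph.isOpenMap _) _ hK

/-- A conjugate `g K g⁻¹` of a compact subgroup is compact. [cite: Kottwitz1986, §3] -/
theorem isCompact_map_conj (K : Subgroup G) (hK : IsCompact (K : Set G)) (g : G) :
    IsCompact ((K.map (MulAut.conj g).toMonoidHom : Subgroup G) : Set G) := by
  rw [Subgroup.coe_map]
  have : (⇑(MulAut.conj g).toMonoidHom : G → G) = (Homeomorph.mulLeft g).trans (Homeomorph.mulRight g⁻¹) := by
    ext x; rfl
  rw [this]
  exact hK.image (Homeomorph.continuous _)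

end Conj

/-! ## §3 The packaged finiteness triple of the elliptic Euler–Poincaré relation -/

section Triple

variable {G : Type*} [Group G] [TopologicalSpace G] [IsTopologicalGroup G] [LocallyCompactSpace G]
  [SecondCountableTopology G] [T2Space G] (γ : G) [CompactSpace (Subgroup.centralizer ({γ} : Set G))]

/-- **THE THREE FINITENESS INPUTS OF THE TREE-SIDE EULER–POINCARÉ RELATION** (★ `HermitianLatticeTree.natCard_fixedBy_add_eq_natCard_fixedBy_add_one_congr`,
binders `hCfin hC′fin horb`) for an element `γ` with compact centraliser and closed conjugacy class (a regular elliptic element) and compact open levels `C, C′`: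
`Fix_γ(G ⧸ C)` and `Fix_γ(G ⧸ C′)` are finite (★ `finite_fixedBy_quotient_of_isClosed`) and the `⟨γ⟩`-orbit of the base coset of `C` is finite (§1).
[cite: Kottwitz1988, §2] [cite: Kottwitz1986, §3] [cite: Laumon1995, Lemma (5.3.2) p. 136] -/
theorem finite_fixedBy_quotient_and_of_isClosed (hO : IsClosed {g | ∃ y : G, y * γ * y⁻¹ = g}) (C C' : Subgroup G)
    (hCo : IsOpen (C : Set G)) (hCc : IsCompact (C : Set G)) (hC'o : IsOpen (C' : Set G)) (hC'c : IsCompact (C' : Set G)) :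
    (MulAction.fixedBy (G ⧸ C) γ).Finite ∧ (MulAction.fixedBy (G ⧸ C') γ).Finite ∧ (Set.range fun n : ℕ => ((γ ^ n : G) : G ⧸ C)).Finite :=
  ⟨finite_fixedBy_quotient_of_isClosed γ C hO hCo hCc, finite_fixedBy_quotient_of_isClosed γ C' hO hC'o hC'c,
    finite_range_pow_quotient_of_isOpen γ C hCo⟩

/-- The same triple with the second level the CONJUGATE `C′ = g C g⁻¹` of the first (the two vertex stabilisers `K`, `K′ = g₁ K g₁⁻¹` of the tree of a rank-one
group). [cite: Kottwitz1988, §2] [cite: Kottwitz1986, §3] -/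
theorem finite_fixedBy_quotient_and_map_conj_of_isClosed (hO : IsClosed {g | ∃ y : G, y * γ * y⁻¹ = g}) (C : Subgroup G)
    (hCo : IsOpen (C : Set G)) (hCc : IsCompact (C : Set G)) (g : G) :
    (MulAction.fixedBy (G ⧸ C) γ).Finite ∧ (MulAction.fixedBy (G ⧸ C.map (MulAut.conj g).toMonoidHom) γ).Finite ∧
      (Set.range fun n : ℕ => ((γ ^ n : G) : G ⧸ C)).Finite :=
  finite_fixedBy_quotient_and_of_isClosed γ hO C _ hCo hCc (isOpen_map_conj C hCo g) (isCompact_map_conj C hCc g)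

end Triple

end Literature.NumberTheory.Automorphic
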